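import Literature.NumberTheory.Automorphic.UnitaryGroupTruncatedTracePolynomialExpansion
import Literature.NumberTheory.Automorphic.UnitaryGroupTruncatedKernelClassOffBorel
import HarnessLib

/-!
# Off `B(F)` the class polynomial is the constant `J_𝔬(f)`; the constant term of the fine `𝔬`-expansion splits as
# `J(f) = Σ_{𝔬 ∈ S_f, 𝔬 ∩ B(F) = ∅} J^T_𝔬(f) + Σ_{𝔬 ∈ S_f, 𝔬 ∩ B(F) ≠ ∅} p_𝔬(0)` on the quasi-split `U(J₃)` of a CM field

(Rogawski, *Automorphic Representations of Unitary Groups in Three Variables* (1990), §2.2–2.3 pp. 13–14: the classes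
`𝔬` with `𝔬 ∩ P(F) = ∅` for every proper parabolic `P` contribute `J_𝔬(f) = J^T_𝔬(f)`, independent of `T`; Arthur,
Duke Math. J. 45 (1978), §8; Arthur, Ann. of Math. 114 (1981), Prop. 2.3; Shokranian (1992), §5.2.)

Topic `NumberTheory/Automorphic`; namespace `Literature.NumberTheory.Automorphic.UnitaryGroup`. THEOREMS ONLY over
accepted tree modules: no definition, no named fact, no instance, no notation, no `sorry`. Item (3d) of the T1-qs road
of `Cruxes/H413/Lines/F0_T1InnerFormTraceIdentity.lean` (cell `pub/hodgecm-mathlib`, crux H413): the glue between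
★ (L4-a) `UnitaryGroupTruncatedKernelClassOffBorel` («a class missing `B(F)` is untruncated, `J^T_𝔬(f)` does not
depend on `T`, `ν`, `𝓕`») and the ★ LAW-3 closer `UnitaryGroupTruncatedTracePolynomialExpansion` («`J(f) =
Σ_{𝔬 ∈ S_f} p_𝔬(0)`»).

* §1 (pure) `polynomial_eq_of_forall_eval_log_eq`, `polynomial_eq_C_of_forall_eval_log_eq` — a complex polynomial
  is determined by its values at the points `log T`, `T > T₀`.
* §2 (generic `F, E, c, N, cl, i` with `hi : ∀ β : B(F), cl β ≠ i`) `classPolynomial_eq_C_of_forall_ne` — any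
  polynomial computing `J^T_𝔬(f)` above a threshold IS the constant `C (J^T_𝔬(f))` (any `T`, `ν'`, `𝓕'`); hence
  `classPolynomial_eval_eq_truncatedTraceClass_of_forall_ne` («`p_𝔬(z) = J^T_𝔬(f)`», in particular `p_𝔬(0)`) and
  `classPolynomial_eval_eq_integral_kernelClass_of_forall_ne` («`p_𝔬(z) = ∫ K_𝔬(x, x) dμ(x)`»).
* §3 (the CM pair, class map `charpoly ∘ adelicVal`, NO hypothesis)
  **`arthurTrace_eq_sum_offBorel_add_sum_charpoly_cm`** — with the LAW-3 closer's data `S_f`, `(p_𝔬)`: the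
  off-`B(F)` class polynomials are the constants `C (J^T_𝔬(f))`, and for EVERY `T`,
  `J(f) = Σ_{𝔬 ∈ S_f, off B(F)} J^T_𝔬(f) + Σ_{𝔬 ∈ S_f, meeting B(F)} p_𝔬(0)`.

## References

* J. D. Rogawski, *Automorphic Representations of Unitary Groups in Three Variables*, Ann. of Math. Stud. 123
  (1990), §2.2–2.3 (pp. 13–14) [Rogawski1990].
* J. Arthur, *The trace formula in invariant form*, Ann. of Math. 114 (1981), Prop. 2.3
  [Arthur1981TraceFormulaInvariantForm].
* S. Shokranian, *The Selberg–Arthur Trace Formula*, LNM 1503 (1992), Thm. (5.7), Rem. (5.8), §5.2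
  [Shokranian1992].
-/

set_option autoImplicit false

noncomputable section

open MeasureTheory Measure NumberField NumberField.mixedEmbedding IsDedekindDomain Set Polynomial
open scoped NNReal ENNReal Pointwise MatrixGroups Classical

namespace Literature.NumberTheory.Automorphic

namespace UnitaryGroup

/-! ## §1 A polynomial is determined by its values at `log T`, `T > T₀` -/

/-- Two complex polynomials that agree at `log T` for every `T > T₀` are equal (the points `log T`, `T > max T₀ 1`,
form an infinite set). [cite: Shokranian1992, Thm. (5.7) and Rem. (5.8)] -/
theorem polynomial_eq_of_forall_eval_log_eq {P Q : ℂ[X]} {T₀ : ℝ≥0}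
    (h : ∀ T : ℝ≥0, T₀ < T → P.eval ((Real.log (T : ℝ) : ℝ) : ℂ) = Q.eval ((Real.log (T : ℝ) : ℝ) : ℂ)) :
    P = Q := by
  apply Polynomial.eq_of_infinite_eval_eq
  let ι : ℝ≥0 → ℂ := fun T => ((Real.log (T : ℝ) : ℝ) : ℂ)
  have hinj : Set.InjOn ι (Set.Ioi (max T₀ 1)) := by
    intro a ha b hb hab
    have ha0 : (0 : ℝ) < (a : ℝ) := by
      have : (1 : ℝ≥0) < a := lt_of_le_of_lt (le_max_right _ _) ha
      exact_mod_cast lt_trans zero_lt_one this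
    have hb0 : (0 : ℝ) < (b : ℝ) := by
      have : (1 : ℝ≥0) < b := lt_of_le_of_lt (le_max_right _ _) hb
      exact_mod_cast lt_trans zero_lt_one this
    have h' : Real.log (a : ℝ) = Real.log (b : ℝ) := by
      change ((Real.log (a : ℝ) : ℝ) : ℂ) = ((Real.log (b : ℝ) : ℝ) : ℂ) at hab
      exact_mod_cast hab
    exact_mod_cast Real.log_injOn_pos ha0 hb0 h'
  refine ((Set.Ioi_infinite (max T₀ 1)).image hinj).mono ?_
  rintro z ⟨T, hT, rfl⟩
  exact h T (lt_of_le_of_lt (le_max_left _ _) hT)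

/-- A complex polynomial whose values at `log T`, `T > T₀`, are all equal to `a` is the constant `C a`.
[cite: Shokranian1992, Thm. (5.7) and Rem. (5.8)] -/
theorem polynomial_eq_C_of_forall_eval_log_eq {P : ℂ[X]} {a : ℂ} {T₀ : ℝ≥0}
    (h : ∀ T : ℝ≥0, T₀ < T → P.eval ((Real.log (T : ℝ) : ℝ) : ℂ) = a) : P = C a :=
  polynomial_eq_of_forall_eval_log_eq (Q := C a) fun T hT => by rw [h T hT, eval_C]

/-! ## §2 Off `B(F)` the class polynomial is the constant `J^T_𝔬(f)` (generic) -/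

section Generic

variable {F E : Type} [Field F] [NumberField F] [Field E] [NumberField E] [Algebra F E]
  {c : E ≃ₐ[F] E} {N : ℕ} {ι : Type*} [NeZero N] [MeasurableSpace (adelicUnipotent F E c N)]
  {cl : (quasiSplit F E c N).arithmeticSubgroup → ι} {i : ι}
  {μ : Measure (quasiSplit F E c N).automorphicQuotient}
  {ν : Measure (adelicUnipotent F E c N)} {𝓕 : Set (adelicUnipotent F E c N)}
  {f : (quasiSplit F E c N).Adelic → ℂ} {P : ℂ[X]} {T₀ : ℝ≥0}

/-- **For a class `𝔬` missing `B(F)`, a polynomial computing `J^T_𝔬(f)` above a threshold is the CONSTANT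
`C (J^T_𝔬(f))`** — for any `T`, `ν'`, `𝓕'` (★ `truncatedTraceClass_eq_of_forall_ne`: `J^T_𝔬(f)` does not depend on
them). The degree-`0` case of [Arthur 1981, Prop. 2.3]. [cite: Rogawski1990, §2.2 (p. 13)]
[cite: Arthur1981TraceFormulaInvariantForm, Prop. 2.3] -/
theorem classPolynomial_eq_C_of_forall_ne (hi : ∀ β : arithmeticBorel F E c N, cl β ≠ i)
    (hP : ∀ T : ℝ≥0, T₀ < T → truncatedTraceClass μ ν 𝓕 T cl i f = P.eval ((Real.log (T : ℝ) : ℝ) : ℂ))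
    (ν' : Measure (adelicUnipotent F E c N)) (𝓕' : Set (adelicUnipotent F E c N)) (T : ℝ≥0) :
    P = C (truncatedTraceClass μ ν' 𝓕' T cl i f) :=
  polynomial_eq_C_of_forall_eval_log_eq (T₀ := T₀) fun T' hT' => by
    rw [← hP T' hT', truncatedTraceClass_eq_of_forall_ne hi μ ν ν' 𝓕 𝓕' T' T f]

/-- Hence **`p_𝔬(z) = J^T_𝔬(f)`** at every `z` (in particular `J_𝔬(f) := p_𝔬(0) = J^T_𝔬(f)`), for any `T`,
`ν'`, `𝓕'`. [cite: Rogawski1990, §2.2 (p. 13)] [cite: Shokranian1992, §5.2] -/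
theorem classPolynomial_eval_eq_truncatedTraceClass_of_forall_ne (hi : ∀ β : arithmeticBorel F E c N, cl β ≠ i)
    (hP : ∀ T : ℝ≥0, T₀ < T → truncatedTraceClass μ ν 𝓕 T cl i f = P.eval ((Real.log (T : ℝ) : ℝ) : ℂ))
    (ν' : Measure (adelicUnipotent F E c N)) (𝓕' : Set (adelicUnipotent F E c N)) (T : ℝ≥0) (z : ℂ) :
    P.eval z = truncatedTraceClass μ ν' 𝓕' T cl i f := by
  rw [classPolynomial_eq_C_of_forall_ne hi hP ν' 𝓕' T, eval_C]

/-- And **`p_𝔬(z) = ∫_{G(F)\G(𝔸_F)} K_𝔬(x, x) dμ(x)`** — the integral of the descended diagonal class kernel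
(★ `truncatedTraceClass_eq_integral_kernelClass_of_forall_ne`). [cite: Rogawski1990, §2.2 (p. 13)]
[cite: Shokranian1992, §5.2] -/
theorem classPolynomial_eval_eq_integral_kernelClass_of_forall_ne (hi : ∀ β : arithmeticBorel F E c N, cl β ≠ i)
    (hP : ∀ T : ℝ≥0, T₀ < T → truncatedTraceClass μ ν 𝓕 T cl i f = P.eval ((Real.log (T : ℝ) : ℝ) : ℂ))
    (z : ℂ) : P.eval z = ∫ x, (quasiSplit F E c N).quotFun (fun g => kernelClass cl i f g g) x ∂μ := by
  rw [classPolynomial_eval_eq_truncatedTraceClass_of_forall_ne hi hP ν 𝓕 T₀ z,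
    truncatedTraceClass_eq_integral_kernelClass_of_forall_ne hi]

/-- The natural-degree form: off `B(F)` a class polynomial has degree `0`. [cite: Arthur1981TraceFormulaInvariantForm, Prop. 2.3] -/
theorem classPolynomial_natDegree_eq_zero_of_forall_ne (hi : ∀ β : arithmeticBorel F E c N, cl β ≠ i)
    (hP : ∀ T : ℝ≥0, T₀ < T → truncatedTraceClass μ ν 𝓕 T cl i f = P.eval ((Real.log (T : ℝ) : ℝ) : ℂ)) :
    P.natDegree = 0 := by
  rw [classPolynomial_eq_C_of_forall_ne hi hP ν 𝓕 T₀, natDegree_C]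

end Generic

/-! ## §3 The CM closer: `J(f) = Σ_{𝔬 off B(F)} J^T_𝔬(f) + Σ_{𝔬 meeting B(F)} p_𝔬(0)` -/

/-- **The constant term of the fine `𝔬`-expansion, split at `B(F)`, on the quasi-split `U(J₃)` of a CM extension
`L/L⁺`** (class map `charpoly ∘ adelicVal`, NO hypothesis): for every Haar measure `ν` of `N(𝔸)`, fundamental domain
`𝓕` of `N(L⁺)`, automorphic measure `μ` and test function `f` there are the LAW-3 closer's finite set `S_f` of classes
and class polynomials `p_𝔬` (all of degree `≤ 1`, `p_𝔬` computing `J^T_𝔬(f)` above a threshold for `𝔬 ∈ S_f`,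
`Σ_{𝔬 ∈ S_f} p_𝔬 =` Arthur's polynomial of `f`) such that every `p_𝔬` with `𝔬 ∈ S_f` missing `B(F)` is the constant
`C (J^T_𝔬(f))` (any `T`), and for EVERY `T`:
**`J(f) = Σ_{𝔬 ∈ S_f, 𝔬 ∩ B(F) = ∅} J^T_𝔬(f) + Σ_{𝔬 ∈ S_f, 𝔬 ∩ B(F) ≠ ∅} p_𝔬(0)`**. (The first sum is where
the elliptic orbital integrals of Rogawski §2.3 enter, class by class, by `Finset.sum_congr`.)
[cite: Rogawski1990, §2.2–2.3 (pp. 13–14)] [cite: Arthur1981TraceFormulaInvariantForm, Prop. 2.3]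
[cite: Shokranian1992, §5.2] -/
theorem arthurTrace_eq_sum_offBorel_add_sum_charpoly_cm (L : Type) [Field L] [NumberField L] [IsCMField L] :
    ∀ [MeasurableSpace (adelicUnipotent (↥(maximalRealSubfield L)) L (IsCMField.complexConj L) 3)]
      [BorelSpace (adelicUnipotent (↥(maximalRealSubfield L)) L (IsCMField.complexConj L) 3)]
      (ν : Measure (adelicUnipotent (↥(maximalRealSubfield L)) L (IsCMField.complexConj L) 3)) [ν.IsHaarMeasure]
      (𝓕 : Set (adelicUnipotent (↥(maximalRealSubfield L)) L (IsCMField.complexConj L) 3)),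
      IsFundamentalDomain (rationalUnipotent (↥(maximalRealSubfield L)) L (IsCMField.complexConj L) 3) 𝓕 ν →
        ∀ (μ : Measure (quasiSplit (↥(maximalRealSubfield L)) L (IsCMField.complexConj L) 3).automorphicQuotient)
          [(quasiSplit (↥(maximalRealSubfield L)) L (IsCMField.complexConj L) 3).IsAutomorphicMeasure μ]
          (f : (quasiSplit (↥(maximalRealSubfield L)) L (IsCMField.complexConj L) 3).Adelic → ℂ),
          IsQuasiSplitTest (↥(maximalRealSubfield L)) L (IsCMField.complexConj L) 3 f →
          ∃ S : Finset (AdeleRing (𝓞 L) L)[X], ∃ P : (AdeleRing (𝓞 L) L)[X] → ℂ[X],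
            (∀ i, (P i).natDegree ≤ 1) ∧
            (∀ i ∈ S, ∃ T₀ : ℝ≥0, ∀ T : ℝ≥0, T₀ < T → truncatedTraceClass μ ν 𝓕 T
                (fun γ : ↥(quasiSplit (↥(maximalRealSubfield L)) L (IsCMField.complexConj L) 3).arithmeticSubgroup =>
                  ((adelicVal (↥(maximalRealSubfield L)) L (IsCMField.complexConj L) 3 _ (γ : (quasiSplit (↥(maximalRealSubfield L)) L (IsCMField.complexConj L) 3).Adelic) :
                    GL (Fin 3) (AdeleRing (𝓞 L) L)) : Matrix (Fin 3) (Fin 3) (AdeleRing (𝓞 L) L)).charpoly) i f =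
                  (P i).eval ((Real.log (T : ℝ) : ℝ) : ℂ)) ∧
            truncatedTracePolynomial μ ν 𝓕 f = ∑ i ∈ S, P i ∧
            (∀ i ∈ S, (∀ β : arithmeticBorel (↥(maximalRealSubfield L)) L (IsCMField.complexConj L) 3,
                (fun γ : ↥(quasiSplit (↥(maximalRealSubfield L)) L (IsCMField.complexConj L) 3).arithmeticSubgroup =>
                  ((adelicVal (↥(maximalRealSubfield L)) L (IsCMField.complexConj L) 3 _ (γ : (quasiSplit (↥(maximalRealSubfield L)) L (IsCMField.complexConj L) 3).Adelic) :
                    GL (Fin 3) (AdeleRing (𝓞 L) L)) : Matrix (Fin 3) (Fin 3) (AdeleRing (𝓞 L) L)).charpoly) β ≠ i) →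
              ∀ T : ℝ≥0, P i = C (truncatedTraceClass μ ν 𝓕 T
                (fun γ : ↥(quasiSplit (↥(maximalRealSubfield L)) L (IsCMField.complexConj L) 3).arithmeticSubgroup =>
                  ((adelicVal (↥(maximalRealSubfield L)) L (IsCMField.complexConj L) 3 _ (γ : (quasiSplit (↥(maximalRealSubfield L)) L (IsCMField.complexConj L) 3).Adelic) :
                    GL (Fin 3) (AdeleRing (𝓞 L) L)) : Matrix (Fin 3) (Fin 3) (AdeleRing (𝓞 L) L)).charpoly) i f)) ∧
            ∀ T : ℝ≥0, arthurTrace μ ν 𝓕 f =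
              (∑ i ∈ S.filter (fun i => ∀ β : arithmeticBorel (↥(maximalRealSubfield L)) L (IsCMField.complexConj L) 3,
                (fun γ : ↥(quasiSplit (↥(maximalRealSubfield L)) L (IsCMField.complexConj L) 3).arithmeticSubgroup =>
                  ((adelicVal (↥(maximalRealSubfield L)) L (IsCMField.complexConj L) 3 _ (γ : (quasiSplit (↥(maximalRealSubfield L)) L (IsCMField.complexConj L) 3).Adelic) :
                    GL (Fin 3) (AdeleRing (𝓞 L) L)) : Matrix (Fin 3) (Fin 3) (AdeleRing (𝓞 L) L)).charpoly) β ≠ i),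
                truncatedTraceClass μ ν 𝓕 T
                  (fun γ : ↥(quasiSplit (↥(maximalRealSubfield L)) L (IsCMField.complexConj L) 3).arithmeticSubgroup =>
                    ((adelicVal (↥(maximalRealSubfield L)) L (IsCMField.complexConj L) 3 _ (γ : (quasiSplit (↥(maximalRealSubfield L)) L (IsCMField.complexConj L) 3).Adelic) :
                      GL (Fin 3) (AdeleRing (𝓞 L) L)) : Matrix (Fin 3) (Fin 3) (AdeleRing (𝓞 L) L)).charpoly) i f) +
              ∑ i ∈ S.filter (fun i => ¬ ∀ β : arithmeticBorel (↥(maximalRealSubfield L)) L (IsCMField.complexConj L) 3,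
                (fun γ : ↥(quasiSplit (↥(maximalRealSubfield L)) L (IsCMField.complexConj L) 3).arithmeticSubgroup =>
                  ((adelicVal (↥(maximalRealSubfield L)) L (IsCMField.complexConj L) 3 _ (γ : (quasiSplit (↥(maximalRealSubfield L)) L (IsCMField.complexConj L) 3).Adelic) :
                    GL (Fin 3) (AdeleRing (𝓞 L) L)) : Matrix (Fin 3) (Fin 3) (AdeleRing (𝓞 L) L)).charpoly) β ≠ i),
                (P i).eval 0 := by
  intro mN bN ν hν 𝓕 h𝓕 μ hμ f hf
  obtain ⟨S, P, hPdeg, hP, -, -, hpoly, harthur⟩ :=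
    arthurTrace_eq_sum_classPolynomial_eval_zero_charpoly_cm L ν 𝓕 h𝓕 μ f hf
  -- the off-`B(F)` class polynomials are constants
  have hC : ∀ i ∈ S, (∀ β : arithmeticBorel (↥(maximalRealSubfield L)) L (IsCMField.complexConj L) 3,
      (fun γ : ↥(quasiSplit (↥(maximalRealSubfield L)) L (IsCMField.complexConj L) 3).arithmeticSubgroup =>
        ((adelicVal (↥(maximalRealSubfield L)) L (IsCMField.complexConj L) 3 _ (γ : (quasiSplit (↥(maximalRealSubfield L)) L (IsCMField.complexConj L) 3).Adelic) :
          GL (Fin 3) (AdeleRing (𝓞 L) L)) : Matrix (Fin 3) (Fin 3) (AdeleRing (𝓞 L) L)).charpoly) β ≠ i) →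
      ∀ T : ℝ≥0, P i = C (truncatedTraceClass μ ν 𝓕 T
        (fun γ : ↥(quasiSplit (↥(maximalRealSubfield L)) L (IsCMField.complexConj L) 3).arithmeticSubgroup =>
          ((adelicVal (↥(maximalRealSubfield L)) L (IsCMField.complexConj L) 3 _ (γ : (quasiSplit (↥(maximalRealSubfield L)) L (IsCMField.complexConj L) 3).Adelic) :
            GL (Fin 3) (AdeleRing (𝓞 L) L)) : Matrix (Fin 3) (Fin 3) (AdeleRing (𝓞 L) L)).charpoly) i f) := by
    intro i hi hiB T
    obtain ⟨T₀, hT₀⟩ := hP i hi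
    exact classPolynomial_eq_C_of_forall_ne hiB hT₀ ν 𝓕 T
  refine ⟨S, P, hPdeg, hP, hpoly, hC, fun T => ?_⟩
  rw [harthur, ← Finset.sum_filter_add_sum_filter_not S (fun i =>
    ∀ β : arithmeticBorel (↥(maximalRealSubfield L)) L (IsCMField.complexConj L) 3,
      (fun γ : ↥(quasiSplit (↥(maximalRealSubfield L)) L (IsCMField.complexConj L) 3).arithmeticSubgroup =>
        ((adelicVal (↥(maximalRealSubfield L)) L (IsCMField.complexConj L) 3 _ (γ : (quasiSplit (↥(maximalRealSubfield L)) L (IsCMField.complexConj L) 3).Adelic) :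
          GL (Fin 3) (AdeleRing (𝓞 L) L)) : Matrix (Fin 3) (Fin 3) (AdeleRing (𝓞 L) L)).charpoly) β ≠ i)]
  congr 1
  refine Finset.sum_congr rfl fun i hi => ?_
  rw [Finset.mem_filter] at hi
  rw [hC i hi.1 hi.2 T, eval_C]

end UnitaryGroup

end Literature.NumberTheory.Automorphic
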